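import Summits.ValiantsHypothesis.ValiantsHypothesis.Theorems.KPlusLogSqLawWeakLiftingTowerGraftTwoSidedClusteredFourLetters
import Summits.ValiantsHypothesis.ValiantsHypothesis.Theorems.KPlusLogSqLawWeakLiftingTowerGraftTwoSidedThreeLettersDefinite

/-!
# The clustered four-letter `2m` law for DEFINITE-TYPE roots of any corank (pub-symmetroid LINE (B) `tower_graft`, helper lane)

Part G (`TwoSidedThree.card_posRoots_le_two_mul_four_letters`) proves `Z₊ ≤ 2m` for the clustered four-letter word
`X^{d₀}P₀ + X^{d₀+2g}J + X^{d₀+3g}B + X^{d₀+4g}C` (`P₀ ≻ 0`, `C ≻ 0`, `B ⪰ 0`, `J` any symmetric) under SIMPLE CROSSINGS.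
Here the corank restriction is removed, exactly as part D did for three letters: the abstract clustered certificate theorem is
re-proved for FAMILIES of kernel vectors with repeated scales (`card_negType_le_rank_clustered_family`: for a same-scale pair the
Gram identity is supplied as a hypothesis `hsame`, which an orthogonal choice of kernel bases realises), instantiated for four
letters (`card_negType_family_le_rank_four_letters`, orthogonality for the form `2P₀ − τ³B − 2τ⁴C`), and assembled with
`exists_kernel_orthogonal_family`, `Inertia.sum_corank_eq_card_roots_filter` and `Inertia.global_index_formula` into
`card_posRoots_le_two_mul_four_letters_of_definite`: every positive root of DEFINITE type (any corank) ⇒ `Z₊(mult) ≤ 2m`.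

Honest scope: clustered supports `(d₀, d₀+2g, d₀+3g, d₀+4g)` only (towers escape, `…TwoSidedTowerEscape`); nothing on
S4/S4b/S4d/S4f/S5, (TB), 19561 proper, 18050, VP ≠ VNP.
-/

set_option linter.dupNamespace false
set_option autoImplicit false

namespace Summit.ValiantsHypothesis.ValiantsHypothesis.Theorems.KPlusLogSqLaw.TowerGraft

open Matrix
open scoped BigOperators

namespace TwoSidedThree

section ClusteredFamily

variable {m : ℕ} {I : Type} [Fintype I] [DecidableEq I] {L : ℕ}

variable (P₀ J : Matrix (Fin m) (Fin m) ℝ) (P : Fin L → Matrix (Fin m) (Fin m) ℝ) (e : ℕ) (d : Fin L → ℕ)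
  (τ : I → ℝ) (u : I → Fin m → ℝ)

/-- **THE CLUSTERED-UPPER LAW for families with repeated scales.**  As `card_negType_le_rank_clustered`, but the scales `τᵢ` need
not be distinct: the off-diagonal certificate relation is only required for `τᵢ ≠ τₖ`, and for a same-scale pair `i ≠ k` the Gram
identity `⟨uᵢ,P₀uₖ⟩ = Σₗ Nₗ[i,k]·⟨uᵢ,Pₗuₖ⟩` is supplied directly (`hsame`; realisable by an orthogonal choice of kernel bases).
Conclusion: the number of ENTERING-type kernel pairs is at most `rank P₀`. [folklore] -/
theorem card_negType_le_rank_clustered_family (hP₀ : P₀.PosSemidef) (hJ : J.IsSymm) (hP : ∀ l, (P l).PosSemidef)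
    (hτ : ∀ i, 0 < τ i) (he : 0 < e)
    (hker : ∀ i, (P₀ + τ i ^ e • J + ∑ l, τ i ^ d l • P l) *ᵥ u i = 0)
    (htype : ∀ i, ∑ l, ((d l - e : ℕ) : ℝ) * τ i ^ d l * (u i ⬝ᵥ (P l *ᵥ u i)) < e * (u i ⬝ᵥ (P₀ *ᵥ u i)))
    (N : Fin L → Matrix I I ℝ) (hN : ∀ l, (N l).PosSemidef)
    (hNdiag : ∀ l i, (e : ℝ) * N l i i = ((d l - e : ℕ) : ℝ) * τ i ^ d l)
    (hNoff : ∀ l i k, τ i ≠ τ k → N l i k * (τ i ^ e - τ k ^ e) = τ i ^ d l * τ k ^ e - τ i ^ e * τ k ^ d l)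
    (hsame : ∀ i k, i ≠ k → τ i = τ k → u i ⬝ᵥ (P₀ *ᵥ u k) = ∑ l, (u i ⬝ᵥ (P l *ᵥ u k)) * N l i k) :
    Fintype.card I ≤ P₀.rank := by
  classical
  have hP₀s : P₀.IsSymm := by
    have h1 := hP₀.1; unfold Matrix.IsHermitian at h1
    rwa [Matrix.conjTranspose_eq_transpose_of_trivial] at h1
  have hPs : ∀ l, (P l).IsSymm := by
    intro l; have h1 := (hP l).1; unfold Matrix.IsHermitian at h1
    rwa [Matrix.conjTranspose_eq_transpose_of_trivial] at h1
  have hepos : (0 : ℝ) < e := Nat.cast_pos.mpr he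
  set S : Matrix I I ℝ := ∑ l, (Matrix.of fun i' k' => u i' ⬝ᵥ (P l *ᵥ u k')) ⊙ N l with hSdef
  have hS : S.PosSemidef := posSemidef_sum _ fun l => (posSemidef_gram (hP l) u).hadamard (hN l)
  set Δ : I → ℝ := fun i => u i ⬝ᵥ (P₀ *ᵥ u i) - ∑ l, (u i ⬝ᵥ (P l *ᵥ u i)) * N l i i with hΔdef
  have hΔpos : ∀ i, 0 < Δ i := by
    intro i
    have ht := htype i
    have h1 : (e : ℝ) * ∑ l, (u i ⬝ᵥ (P l *ᵥ u i)) * N l i i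
        = ∑ l, ((d l - e : ℕ) : ℝ) * τ i ^ d l * (u i ⬝ᵥ (P l *ᵥ u i)) := by
      rw [Finset.mul_sum]
      refine Finset.sum_congr rfl fun l _ => ?_
      rw [show (e : ℝ) * ((u i ⬝ᵥ (P l *ᵥ u i)) * N l i i) = ((e : ℝ) * N l i i) * (u i ⬝ᵥ (P l *ᵥ u i)) by ring,
        hNdiag l i]
    have h2 : (e : ℝ) * Δ i = e * (u i ⬝ᵥ (P₀ *ᵥ u i)) - ∑ l, ((d l - e : ℕ) : ℝ) * τ i ^ d l * (u i ⬝ᵥ (P l *ᵥ u i)) := by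
      simp only [hΔdef]; rw [mul_sub, h1]
    have h3 : 0 < (e : ℝ) * Δ i := by rw [h2]; linarith
    exact pos_of_mul_pos_right h3 hepos.le
  have hdecomp : (Matrix.of fun i' k' => u i' ⬝ᵥ (P₀ *ᵥ u k')) = S + Matrix.diagonal Δ := by
    ext i k
    rw [Matrix.add_apply, Matrix.of_apply, hSdef, Matrix.sum_apply]
    simp only [Matrix.hadamard_apply, Matrix.of_apply]
    by_cases hik : i = k
    · subst hik
      rw [Matrix.diagonal_apply_eq]
      simp only [hΔdef]; ring
    · rw [Matrix.diagonal_apply_ne _ hik, add_zero]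
      by_cases hτik : τ i = τ k
      · exact hsame i k hik hτik
      · have hne : τ i ^ e - τ k ^ e ≠ 0 := by
          intro h0
          exact hτik ((pow_left_inj₀ (hτ i).le (hτ k).le (Nat.pos_iff_ne_zero.mp he)).mp (sub_eq_zero.mp h0))
        have hg := gramP0_eq_clustered P₀ J P e d τ u hP₀s hJ hPs hker i k
        apply mul_left_cancel₀ hne
        rw [hg, Finset.mul_sum]
        refine Finset.sum_congr rfl fun l _ => ?_
        rw [← hNoff l i k hτik]
        ring
  have hG : (Matrix.of fun i' k' => u i' ⬝ᵥ (P₀ *ᵥ u k')).PosDef := by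
    rw [Matrix.posDef_iff_dotProduct_mulVec]
    refine ⟨(posSemidef_gram hP₀ u).1, fun x hx => ?_⟩
    rw [hdecomp, Matrix.add_mulVec, dotProduct_add]
    have h1 : 0 ≤ star x ⬝ᵥ (S *ᵥ x) := (Matrix.posSemidef_iff_dotProduct_mulVec.mp hS).2 x
    have h2 : 0 < star x ⬝ᵥ (Matrix.diagonal Δ *ᵥ x) := by
      rw [star_trivial]
      simp only [dotProduct, Matrix.mulVec_diagonal]
      obtain ⟨i₀, hi₀⟩ := Function.ne_iff.mp hx
      apply Finset.sum_pos'
      · intro i _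
        have := hΔpos i
        nlinarith [sq_nonneg (x i)]
      · refine ⟨i₀, Finset.mem_univ _, ?_⟩
        have := hΔpos i₀
        have hx0 : 0 < x i₀ ^ 2 := sq_pos_iff.mpr hi₀
        nlinarith
    linarith
  have hrank : (Matrix.of fun i' k' => u i' ⬝ᵥ (P₀ *ᵥ u k')).rank = Fintype.card I := Matrix.rank_of_isUnit _ hG.isUnit
  rw [← hrank]
  exact rank_gram_le P₀ u

/-- **four-letter family instance** (`P₀ + τ²J + τ³B + τ⁴C`; scales may repeat).  Certificates `N_B = [τᵢ²τₖ²/(τᵢ+τₖ)]`,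
`N_C = [τᵢ²τₖ²]` as in `card_negType_le_rank_four_letters`; for a same-scale pair the Gram identity amounts to orthogonality for the
symmetric form `2P₀ − τ³B − 2τ⁴C` (`horth`). [folklore] -/
theorem card_negType_family_le_rank_four_letters (B C : Matrix (Fin m) (Fin m) ℝ) (hP₀ : P₀.PosSemidef) (hJ : J.IsSymm)
    (hB : B.PosSemidef) (hC : C.PosSemidef) (hτ : ∀ i, 0 < τ i)
    (hker : ∀ i, (P₀ + τ i ^ 2 • J + τ i ^ 3 • B + τ i ^ 4 • C) *ᵥ u i = 0)
    (htype : ∀ i, τ i ^ 3 * (u i ⬝ᵥ (B *ᵥ u i)) + 2 * τ i ^ 4 * (u i ⬝ᵥ (C *ᵥ u i)) < 2 * (u i ⬝ᵥ (P₀ *ᵥ u i)))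
    (horth : ∀ i k, i ≠ k → τ i = τ k →
      2 * (u i ⬝ᵥ (P₀ *ᵥ u k)) = τ i ^ 3 * (u i ⬝ᵥ (B *ᵥ u k)) + 2 * τ i ^ 4 * (u i ⬝ᵥ (C *ᵥ u k))) :
    Fintype.card I ≤ P₀.rank := by
  classical
  set NB : Matrix I I ℝ := Matrix.of fun i k => τ i ^ 2 * (1 / (τ i + τ k)) * τ k ^ 2 with hNB
  set NC : Matrix I I ℝ := Matrix.vecMulVec (fun i => τ i ^ 2) (fun i => τ i ^ 2) with hNC
  refine card_negType_le_rank_clustered_family P₀ J ![B, C] 2 ![3, 4] τ u hP₀ hJ ?_ hτ (by norm_num) ?_ ?_ ![NB, NC] ?_ ?_ ?_ ?_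
  · intro l; fin_cases l
    · exact hB
    · exact hC
  · intro i
    have h := hker i
    rw [Fin.sum_univ_two]
    simpa [add_assoc] using h
  · intro i
    rw [Fin.sum_univ_two]
    have h := htype i
    simp only [Matrix.cons_val_zero, Matrix.cons_val_one]
    push_cast
    linarith
  · intro l; fin_cases l
    · show NB.PosSemidef
      have hNeq : NB = (Matrix.diagonal fun i => τ i ^ 2) * (Matrix.of fun i k : I => 1 / (τ i + τ k))
          * (Matrix.diagonal fun i => τ i ^ 2) := by
        ext i k
        simp only [hNB, Matrix.of_apply, Matrix.mul_diagonal, Matrix.diagonal_mul]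
      rw [hNeq]
      have h := (posSemidef_cauchy τ hτ).conjTranspose_mul_mul_same (Matrix.diagonal fun i => τ i ^ 2)
      rwa [Matrix.conjTranspose_eq_transpose_of_trivial, Matrix.diagonal_transpose] at h
    · show NC.PosSemidef
      have h := Matrix.posSemidef_vecMulVec_self_star (R := ℝ) (fun i : I => τ i ^ 2)
      rwa [star_trivial] at h
  · intro l i; fin_cases l
    · show (2 : ℝ) * NB i i = ((3 - 2 : ℕ) : ℝ) * τ i ^ 3
      simp only [hNB, Matrix.of_apply]
      have := ne_of_gt (hτ i)
      field_simp
      ring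
    · show (2 : ℝ) * NC i i = ((4 - 2 : ℕ) : ℝ) * τ i ^ 4
      simp only [hNC, Matrix.vecMulVec_apply]
      push_cast
      ring
  · intro l i k hik; fin_cases l
    · show NB i k * (τ i ^ 2 - τ k ^ 2) = τ i ^ 3 * τ k ^ 2 - τ i ^ 2 * τ k ^ 3
      simp only [hNB, Matrix.of_apply]
      have := ne_of_gt (add_pos (hτ i) (hτ k))
      field_simp
      ring
    · show NC i k * (τ i ^ 2 - τ k ^ 2) = τ i ^ 4 * τ k ^ 2 - τ i ^ 2 * τ k ^ 4
      simp only [hNC, Matrix.vecMulVec_apply]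
      ring
  · intro i k hik hτik
    rw [Fin.sum_univ_two]
    show u i ⬝ᵥ (P₀ *ᵥ u k) = (u i ⬝ᵥ (B *ᵥ u k)) * NB i k + (u i ⬝ᵥ (C *ᵥ u k)) * NC i k
    simp only [hNB, hNC, Matrix.of_apply, Matrix.vecMulVec_apply]
    have h := horth i k hik hτik
    rw [← hτik]
    have hti := ne_of_gt (hτ i)
    have h2 : (1 : ℝ) / (τ i + τ i) = 1 / (2 * τ i) := by ring
    rw [h2]
    field_simp
    linear_combination h

end ClusteredFamily

/-! ## The census-currency law for definite-type roots of any corank -/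

section FourLettersDefinite

open Polynomial
open Summit.ValiantsHypothesis.ValiantsHypothesis.Theorems.LacunarySymmetroidMatrixDescartes

variable {m : ℕ}

/-- **THE FOUR-LETTER `2m` LAW ON CLUSTERED SUPPORTS, DEFINITE TYPE (any corank).**  `P₀ ≻ 0`, `C ≻ 0`, `B ⪰ 0`, `J` ANY symmetric,
`g ≥ 1`, `F(X) = X^{d₀}P₀ + X^{d₀+2g}J + X^{d₀+3g}B + X^{d₀+4g}C`; if every positive root of `det F` is of DEFINITE type (the
derivative form `P_u′(t)` has one strict sign on the kernel — corank unrestricted), then `det F` has at most `2m` positive roots counted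
with multiplicity.  Proof: at each entering root choose a kernel basis orthogonal for `2P₀ − τ³B − 2τ⁴C`
(`exists_kernel_orthogonal_family`); the resulting family obeys `card_negType_family_le_rank_four_letters`, so
`N⁻ = Σ corank ≤ rank P₀ = m` (`Inertia.sum_corank_eq_card_roots_filter`), and `N⁺ = N⁻` (`Inertia.global_index_formula`,
`ν(P₀) = ν(C) = 0`). [folklore] -/
theorem card_posRoots_le_two_mul_four_letters_of_definite (P₀ J B C : Matrix (Fin m) (Fin m) ℝ) (hP₀ : P₀.PosDef)
    (hJ : J.IsSymm) (hB : B.PosSemidef) (hC : C.PosDef) (d₀ g : ℕ) (hg : 0 < g)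
    (htype : ∀ t : ℝ, 0 < t →
      (∑ k : Fin 4, t ^ (![d₀, d₀ + 2 * g, d₀ + 3 * g, d₀ + 4 * g] k) • (![P₀, J, B, C] k)).det = 0 →
      (∀ u : Fin m → ℝ, (∑ k : Fin 4, t ^ (![d₀, d₀ + 2 * g, d₀ + 3 * g, d₀ + 4 * g] k) • (![P₀, J, B, C] k)) *ᵥ u = 0 →
        u ≠ 0 → (derivative (∑ k : Fin 4, Polynomial.C (u ⬝ᵥ ((![P₀, J, B, C] k) *ᵥ u)) *
          (X : ℝ[X]) ^ (![d₀, d₀ + 2 * g, d₀ + 3 * g, d₀ + 4 * g] k))).eval t < 0) ∨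
      (∀ u : Fin m → ℝ, (∑ k : Fin 4, t ^ (![d₀, d₀ + 2 * g, d₀ + 3 * g, d₀ + 4 * g] k) • (![P₀, J, B, C] k)) *ᵥ u = 0 →
        u ≠ 0 → 0 < (derivative (∑ k : Fin 4, Polynomial.C (u ⬝ᵥ ((![P₀, J, B, C] k) *ᵥ u)) *
          (X : ℝ[X]) ^ (![d₀, d₀ + 2 * g, d₀ + 3 * g, d₀ + 4 * g] k))).eval t)) :
    Multiset.card ((Matrix.det (∑ k : Fin 4, ((X : ℝ[X]) ^ (![d₀, d₀ + 2 * g, d₀ + 3 * g, d₀ + 4 * g] k)) •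
      (![P₀, J, B, C] k).map Polynomial.C)).roots.filter (fun t => 0 < t)) ≤ 2 * m := by
  classical
  set dv : Fin 4 → ℕ := ![d₀, d₀ + 2 * g, d₀ + 3 * g, d₀ + 4 * g] with hdv
  set Sv : Fin 4 → Matrix (Fin m) (Fin m) ℝ := ![P₀, J, B, C] with hSv
  have hP₀s : P₀.IsSymm := by
    have h1 := hP₀.1; unfold Matrix.IsHermitian at h1
    rwa [Matrix.conjTranspose_eq_transpose_of_trivial] at h1
  have hBs : B.IsSymm := by
    have h1 := hB.1; unfold Matrix.IsHermitian at h1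
    rwa [Matrix.conjTranspose_eq_transpose_of_trivial] at h1
  have hCs : C.IsSymm := by
    have h1 := hC.1; unfold Matrix.IsHermitian at h1
    rwa [Matrix.conjTranspose_eq_transpose_of_trivial] at h1
  have hS : ∀ k, (Sv k).IsSymm := by
    intro k; fin_cases k
    · exact hP₀s
    · exact hJ
    · exact hBs
    · exact hCs
  have hmin : ∀ l : Fin 4, l ≠ 0 → dv 0 < dv l := by
    intro l hl; fin_cases l
    · exact absurd rfl hl
    · show d₀ < d₀ + 2 * g; omega
    · show d₀ < d₀ + 3 * g; omega
    · show d₀ < d₀ + 4 * g; omega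
  have hmax : ∀ l : Fin 4, l ≠ 3 → dv l < dv 3 := by
    intro l hl; fin_cases l
    · show d₀ < d₀ + 4 * g; omega
    · show d₀ + 2 * g < d₀ + 4 * g; omega
    · show d₀ + 3 * g < d₀ + 4 * g; omega
    · exact absurd rfl hl
  have h0 : (Sv 0).det ≠ 0 := by show P₀.det ≠ 0; exact hP₀.det_pos.ne'
  have h3 : (Sv 3).det ≠ 0 := by show C.det ≠ 0; exact hC.det_pos.ne'
  let negType : ℝ → Prop := fun t => ∀ u : Fin m → ℝ, (∑ k, t ^ dv k • Sv k) *ᵥ u = 0 → u ≠ 0 →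
    (derivative (∑ k, Polynomial.C (u ⬝ᵥ (Sv k *ᵥ u)) * (X : ℝ[X]) ^ dv k)).eval t < 0
  obtain ⟨hidx, -, hsum⟩ := Inertia.global_index_formula dv Sv hS 0 3 hmin hmax h0 h3 htype negType
    (fun t _ _ => Iff.rfl)
  have hν0 : Fintype.card {j // (Inertia.isHermitian_of_isSymm (hS 0)).eigenvalues j < 0} = 0 := by
    rw [Fintype.card_eq_zero_iff]
    refine ⟨fun ⟨j, hj⟩ => ?_⟩
    have hp : 0 < (Inertia.isHermitian_of_isSymm (hS 0)).eigenvalues j := hP₀.eigenvalues_pos j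
    linarith
  have hν3 : Fintype.card {j // (Inertia.isHermitian_of_isSymm (hS 3)).eigenvalues j < 0} = 0 := by
    rw [Fintype.card_eq_zero_iff]
    refine ⟨fun ⟨j, hj⟩ => ?_⟩
    have hp : 0 < (Inertia.isHermitian_of_isSymm (hS 3)).eigenvalues j := hC.eigenvalues_pos j
    linarith
  rw [hν0, hν3, zero_add, zero_add] at hidx
  set P := Matrix.det (∑ k, ((X : ℝ[X]) ^ dv k) • (Sv k).map Polynomial.C) with hP
  set q : ℝ → Prop := fun t => 0 < t ∧ negType t with hq
  -- `N⁻ = ∑ corank` over the distinct entering roots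
  have hdef : ∀ t ∈ P.roots.toFinset.filter q, ∀ v : Fin m → ℝ, (∑ k, t ^ dv k • Sv k) *ᵥ v = 0 → v ≠ 0 →
      (derivative (∑ k, Polynomial.C (v ⬝ᵥ (Sv k *ᵥ v)) * (X : ℝ[X]) ^ dv k)).eval t ≠ 0 := by
    intro t ht v hv hv0
    obtain ⟨hmem, htq⟩ := Finset.mem_filter.mp ht
    obtain ⟨-, hroot⟩ := (Polynomial.mem_roots').mp (Multiset.mem_toFinset.mp hmem)
    have hdet : (∑ k, t ^ dv k • Sv k).det = 0 := by
      have h1 : P.eval t = 0 := hroot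
      rwa [hP, DefiniteMoments.eval_det_pencil] at h1
    rcases htype t htq.1 hdet with h | h
    · exact ne_of_lt (h v hv hv0)
    · exact ne_of_gt (h v hv hv0)
  have hN : ∑ t ∈ P.roots.toFinset.filter q, (Fintype.card (Fin m) - (∑ k, t ^ dv k • Sv k).rank)
      = Multiset.card (P.roots.filter q) := Inertia.sum_corank_eq_card_roots_filter dv Sv hS q hdef
  set T := P.roots.toFinset.filter q with hTdef
  have hTpos : ∀ t ∈ T, 0 < t := fun t ht => (Finset.mem_filter.mp ht).2.1
  have hTtype : ∀ t ∈ T, ∀ u : Fin m → ℝ, (∑ k, t ^ dv k • Sv k) *ᵥ u = 0 → u ≠ 0 →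
      (derivative (∑ k, Polynomial.C (u ⬝ᵥ (Sv k *ᵥ u)) * (X : ℝ[X]) ^ dv k)).eval t < 0 :=
    fun t ht u hu hu0 => (Finset.mem_filter.mp ht).2.2 u hu hu0
  -- an orthogonal kernel family at each root of `T`, for the form `Φ_t = 2P₀ − τ³B − 2τ⁴C`, `τ = t^g`
  have hfam : ∀ t : T, ∃ v : Fin (m - (∑ k, (t : ℝ) ^ dv k • Sv k).rank) → (Fin m → ℝ),
      (∀ j, (∑ k, (t : ℝ) ^ dv k • Sv k) *ᵥ v j = 0) ∧ (∀ j, v j ≠ 0) ∧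
      ∀ j j', j ≠ j' → v j ⬝ᵥ (((2 : ℝ) • P₀ - (((t : ℝ) ^ g) ^ 3) • B - (2 * ((t : ℝ) ^ g) ^ 4) • C) *ᵥ v j') = 0 := by
    intro t
    refine exists_kernel_orthogonal_family _ _ ?_
    unfold Matrix.IsSymm
    rw [Matrix.transpose_sub, Matrix.transpose_sub, Matrix.transpose_smul, Matrix.transpose_smul, Matrix.transpose_smul,
      hP₀s, hBs, hCs]
  choose v hv0 hvne hvorth using hfam
  let Idx := Σ t : T, Fin (m - (∑ k, (t : ℝ) ^ dv k • Sv k).rank)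
  have hcard : Fintype.card Idx = ∑ t ∈ T, (Fintype.card (Fin m) - (∑ k, t ^ dv k • Sv k).rank) := by
    rw [Fintype.card_sigma]
    simp only [Fintype.card_fin]
    exact (Finset.sum_coe_sort T (fun t => m - (∑ k, t ^ dv k • Sv k).rank))
  have hbound : Fintype.card Idx ≤ P₀.rank := by
    refine card_negType_family_le_rank_four_letters (I := Idx) P₀ J (fun p => ((p.1 : ℝ)) ^ g) (fun p => v p.1 p.2) B C
      hP₀.posSemidef hJ hB hC.posSemidef (fun p => pow_pos (hTpos p.1 p.1.2) g)
      (fun p => reduced_kernel4 P₀ J B C d₀ g (hTpos p.1 p.1.2) _ (hv0 p.1 p.2)) ?_ ?_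
    · intro p
      have ht := hTpos p.1 p.1.2
      have hneg := hTtype p.1 p.1.2 (v p.1 p.2) (hv0 p.1 p.2) (hvne p.1 p.2)
      have heq := rayleigh_deriv_eq4 P₀ J B C d₀ g ht _ (hv0 p.1 p.2)
      have h1 : (p.1 : ℝ) * (derivative (∑ k : Fin 4, Polynomial.C (v p.1 p.2 ⬝ᵥ ((![P₀, J, B, C] k) *ᵥ v p.1 p.2)) *
          (X : ℝ[X]) ^ (![d₀, d₀ + 2 * g, d₀ + 3 * g, d₀ + 4 * g] k))).eval (p.1 : ℝ) < 0 :=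
        mul_neg_of_pos_of_neg ht hneg
      rw [heq] at h1
      have h2 : 0 < (g : ℝ) * (p.1 : ℝ) ^ d₀ := mul_pos (Nat.cast_pos.mpr hg) (pow_pos ht _)
      by_contra hcon
      push Not at hcon
      have h3 : 0 ≤ ((p.1 : ℝ) ^ g) ^ 3 * (v p.1 p.2 ⬝ᵥ (B *ᵥ v p.1 p.2))
          + 2 * ((p.1 : ℝ) ^ g) ^ 4 * (v p.1 p.2 ⬝ᵥ (C *ᵥ v p.1 p.2)) - 2 * (v p.1 p.2 ⬝ᵥ (P₀ *ᵥ v p.1 p.2)) := by linarith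
      have := mul_nonneg h2.le h3
      linarith
    · rintro ⟨t, j⟩ ⟨t', j'⟩ hne htt'
      simp only at htt'
      have htt : t = t' := Subtype.ext
        ((pow_left_inj₀ (hTpos t.1 t.2).le (hTpos t'.1 t'.2).le (Nat.pos_iff_ne_zero.mp hg)).mp htt')
      subst htt
      have hjj : j ≠ j' := fun h => hne (by subst h; rfl)
      have h := hvorth t j j' hjj
      rw [Matrix.sub_mulVec, Matrix.sub_mulVec, Matrix.smul_mulVec, Matrix.smul_mulVec, Matrix.smul_mulVec,
        dotProduct_sub, dotProduct_sub, dotProduct_smul, dotProduct_smul, dotProduct_smul, smul_eq_mul, smul_eq_mul,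
        smul_eq_mul] at h
      linarith
  have hP₀m : P₀.rank ≤ m := (Matrix.rank_le_width P₀).trans le_rfl
  rw [← hsum]
  have hNle : Multiset.card (P.roots.filter q) ≤ m := by
    rw [← hN, ← hcard]
    exact hbound.trans hP₀m
  have hidx' : Multiset.card (P.roots.filter fun t => 0 < t ∧ ¬ negType t) = Multiset.card (P.roots.filter q) := hidx
  rw [hidx']
  omega

end FourLettersDefinite

end TwoSidedThree

end Summit.ValiantsHypothesis.ValiantsHypothesis.Theorems.KPlusLogSqLaw.TowerGraft
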